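import Summits.QuantumFields.YangMills.Theorems.BalabanLadderROTTiltBoundaryDecayPos
import HarnessLib

/-!
# Crux `ROT` (stmt-QuantumFields-20042): the repaired infrared input BY NAME — `BoundaryDecayInUnitsPos` / `BoundaryDecayAllPos` closers

Helper file of the fleet lead `ym-spine-20042-p1` (generation g4), `--supports stmt-QuantumFields-20042` (count-neutral).  One-line closers over
the named, repaired infrared input of `Theorems/BalabanLadderROTClassDefs.lean` §6 (p486516; §5's degenerate texts are NOT used) and the repaired
chain of `Theorems/BalabanLadderROTTiltBoundaryDecayPos.lean` (p486406), whose inline hypotheses are the bodies of the §6 definitions verbatim: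

* `tiltInsensitivityOn_of_boundaryDecayInUnitsPos : BoundaryDecayInUnitsPos G r a → TiltInsensitivityOn G r a t.tiltCell (fittedClass t.q)`;
* `ti_of_boundaryDecayAllPos : BoundaryDecayAllPos → TI t.tiltCell (fittedClass t.q)`;
* `kingOnClass_of_nrot3_of_boundaryDecayAllPos`, `rotRev2'_of_nrot3_of_boundaryDecayAllPos : NROT3(S₅) → BoundaryDecayAllPos → ROTRev2'`;
* `tiltedRegComparisonOn_iff_latticeKingWardOn_of_boundaryDecayInUnitsPos`.

Census (typed): `ROTRev2' ⇐ NROT3 king345.tiltCell (arcsin 3/5) (fittedClass 5) ∧ BoundaryDecayAllPos`.  No definition, no sorry.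
-/

set_option autoImplicit false

noncomputable section

open MeasureTheory Filter Topology
open Literature.MathematicalPhysics.QuantumFieldTheory Literature.MathematicalPhysics.QuantumLattice
open Summit.QuantumFields.YangMills.Cruxes.OSLegsFromFemtoAndGap.DlrCollarTransfer
open Summit.QuantumFields.YangMills.Cruxes.OSLegsAtWeakCouplingC.Y2Bridge

namespace Summit.QuantumFields.YangMills.Theorems.ROT

open PythTriple

section Named

variable {G : Type} [Group G] [TopologicalSpace G] [IsTopologicalGroup G] [CompactSpace G]
  [MeasurableSpace G] [BorelSpace G]

/-- **`BoundaryDecayInUnitsPos G r a ⇒` the tilt bracket vanishes along admissible schemes** on the tilt cells of any Pythagorean triple. -/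
theorem tiltInsensitivityOn_of_boundaryDecayInUnitsPos (t : PythTriple) (r : LatticeRep G) (a : ℝ → ℝ)
    (h : BoundaryDecayInUnitsPos G r a) : TiltInsensitivityOn G r a t.tiltCell (fittedClass t.q) :=
  tiltInsensitivityOn_of_boundaryDecayPos t r a h

/-- **Modulo `BoundaryDecayInUnitsPos G r a`, N-ROT.3 on a tilt cell IS King's single-angle lattice Ward statement on the fitted class.** -/
theorem tiltedRegComparisonOn_iff_latticeKingWardOn_of_boundaryDecayInUnitsPos (t : PythTriple) (r : LatticeRep G) (a : ℝ → ℝ)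
    (θ : ℝ) (h : BoundaryDecayInUnitsPos G r a) :
    TiltedRegComparisonOn G r a t.tiltCell θ (fittedClass t.q) ↔ LatticeKingWardOn G r a ({θ} : Set ℝ) (fittedClass t.q) :=
  tiltedRegComparisonOn_iff_latticeKingWardOn_of_boundaryDecayPos t r a θ h

end Named

/-- **`TI ⇐ BoundaryDecayAllPos`** for the tilt cells of any Pythagorean triple on its fitted class. -/
theorem ti_of_boundaryDecayAllPos (t : PythTriple) (h : BoundaryDecayAllPos) : TI t.tiltCell (fittedClass t.q) :=
  ti_of_boundaryDecayPos t fun G _ _ _ _ hG => h G hG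

/-- **`KingOnClass ⇐ N-ROT.3 (King's data) ∧ BoundaryDecayAllPos`.** -/
theorem kingOnClass_of_nrot3_of_boundaryDecayAllPos (h3 : NROT3 king345.tiltCell (Real.arcsin (3 / 5)) (fittedClass 5))
    (h : BoundaryDecayAllPos) : KingOnClass :=
  kingOnClass_of_tilt345 h3 (ti_of_boundaryDecayAllPos king345 h)

/-- **`ROT` rev 2′ (text of record for R85) ⇐ N-ROT.3 (King's data) ∧ BoundaryDecayAllPos** — the typed census of the crux after the tilt half:
the two-regularisation comparison on King's class (leg 1, XL, unprinted) and the repaired infrared input (mass-gap strength). -/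
theorem rotRev2'_of_nrot3_of_boundaryDecayAllPos (h3 : NROT3 king345.tiltCell (Real.arcsin (3 / 5)) (fittedClass 5))
    (h : BoundaryDecayAllPos) : ROTRev2' :=
  rotRev2'_of_nrot3_of_boundaryDecayPos h3 fun G _ _ _ _ hG => h G hG

end Summit.QuantumFields.YangMills.Theorems.ROT

end
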